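import Literature.MathematicalPhysics.QuantumLattice.HubbardTorusLocalHamiltonianDecomposition
import Literature.MathematicalPhysics.QuantumLattice.FreeFermiGasNoPairFieldLRO
import HarnessLib

/-!
# Local stability of torus-limit states: limits of sector ground states of the Hubbard tori are
# ground states for gauge-invariant local perturbations

Topic `Literature/MathematicalPhysics/QuantumLattice`; namespace
`Literature.MathematicalPhysics.QuantumLattice` (the file path). Let `ψ_L` be ground states of the
Hubbard Hamiltonian `hubbardTorus d L t U` in joint sectors `(N_L, S^z = M_L)` of the fermionic tori,
and `ω` a torus limit of their translation averages along `Ls → ∞`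
(`InfVolFermionState.IsTorusLimitOf`). Then `ω` satisfies the Bratteli–Robinson local ground-state
inequality `-i ω(A⋆ δ(A)) ≥ 0` — `δ(A) = i[H_{thicken Λ 1}, A]` the derivation of the Hubbard
interaction (`FermionInteraction.derivation`) — for every local observable `A ∈ 𝔄_Λ` which
conserves the local particle number and the local `S^z` (`Commute A totalNumber`,
`Commute A spinZ`): `IsTorusLimitOf.localStability` / `IsTorusLimitOf.neg_I_mul_expect_derivation_nonneg`.
(For such `A` the embedded observable preserves the sectors, so in finite volume
`⟨ψ, Ã⋆[H_L, Ã]ψ⟩ = ⟨Ãψ, (H_L - E₀)Ãψ⟩ ≥ 0`; the torus commutator is the embedded local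
commutator, `hubbardTorus_commutator_fermionEmbed`; average over translations and pass to the
limit.) This is the canonical (fixed `N`, `S^z`) version of Bratteli–Robinson II Prop. 5.3.25 /
Araki–Moriya §7 (limits of ground states are ground states), restricted — as it must be for
canonical limits — to the gauge-invariant perturbations. No definition, no named fact.
-/

noncomputable section

namespace Literature.MathematicalPhysics.QuantumLattice

open Matrix Finset HubbardWave0 _root_.Filter Literature.Probability.LatticeModels
open scoped _root_.Topology ComplexOrder

/-! ### Finite volume: the ground-state inequality in an invariant sector -/

section FiniteVolume

variable {ι : Type*} [Fintype ι] [DecidableEq ι]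

/-- The sector energy bounds the Rayleigh quotient of every (not necessarily unit) vector of the
sector: `minEnergyOn H K · ‖v‖² ≤ Re ⟨v, Hv⟩` for `v ∈ K`. [cite: Tasaki2020, §2.2] -/
theorem minEnergyOn_mul_le_re_rayleigh_of_mem {H : Matrix ι ι ℂ} (hH : H.IsHermitian)
    (K : Submodule ℂ (ι → ℂ)) {v : ι → ℂ} (hv : v ∈ K) :
    H.minEnergyOn K * (star v ⬝ᵥ v).re ≤ (star v ⬝ᵥ (H *ᵥ v)).re := by
  by_cases hv0 : v = 0
  · simp [hv0]
  obtain ⟨c, hc, h1⟩ := exists_smul_unit hv0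
  have hle := minEnergyOn_le_rayleigh_of_mem hH K (K.smul_mem c hv) h1
  have hcc : (0 : ℝ) < (star c * c).re := by
    rw [Complex.star_def, Complex.conj_mul', ← Complex.ofReal_pow, Complex.ofReal_re]
    exact pow_pos (norm_pos_iff.2 hc) 2
  have hsv : star (c • v) ⬝ᵥ (c • v) = (star c * c) * (star v ⬝ᵥ v) := by
    rw [star_smul, smul_dotProduct, dotProduct_smul, smul_smul, smul_eq_mul]
  have hsH : star (c • v) ⬝ᵥ (H *ᵥ (c • v)) = (star c * c) * (star v ⬝ᵥ (H *ᵥ v)) := by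
    rw [mulVec_smul, star_smul, smul_dotProduct, dotProduct_smul, smul_smul, smul_eq_mul]
  have him : (star c * c).im = 0 := by
    rw [Complex.star_def, Complex.conj_mul', ← Complex.ofReal_pow, Complex.ofReal_im]
  rw [hsH, Complex.mul_re, him, zero_mul, sub_zero] at hle
  rw [hsv] at h1
  have h1' : (star v ⬝ᵥ v).re = ((star c * c).re)⁻¹ := by
    have h := congrArg Complex.re h1
    rw [Complex.mul_re, him, zero_mul, sub_zero, Complex.one_re] at h
    exact eq_inv_of_mul_eq_one_right h
  rw [h1']
  have := mul_le_mul_of_nonneg_left hle (inv_nonneg.2 hcc.le)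
  rw [← mul_assoc, inv_mul_cancel₀ hcc.ne', one_mul] at this
  linarith [this]

/-- **The ground-state inequality in a sector.** Let `H` be Hermitian, `K` a subspace, `φ ∈ K` an
eigenvector of `H` with eigenvalue the sector energy `minEnergyOn H K` (a sector ground state), and
`B` an operator mapping `K` into itself. Then `⟨φ, B⋆ (H B - B H) φ⟩ = ⟨Bφ, (H - E₀) Bφ⟩ ≥ 0`
(in `ComplexOrder`: real and nonnegative). Bratteli–Robinson II Prop. 5.3.19 (the computation
`(1) ⇒ (2)`), finite-dimensional and sector-wise. [cite: BratteliRobinsonII1997, Prop. 5.3.19] -/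
theorem star_dotProduct_conjTranspose_mul_commutator_mulVec_nonneg {H B : Matrix ι ι ℂ} (hH : H.IsHermitian)
    (K : Submodule ℂ (ι → ℂ)) (hBK : ∀ v ∈ K, B *ᵥ v ∈ K) {φ : ι → ℂ} (hφK : φ ∈ K)
    (hφ : H *ᵥ φ = ((H.minEnergyOn K : ℝ) : ℂ) • φ) :
    0 ≤ star φ ⬝ᵥ ((Bᴴ * (H * B - B * H)) *ᵥ φ) := by
  have hexp : star φ ⬝ᵥ ((Bᴴ * (H * B - B * H)) *ᵥ φ) =
      star (B *ᵥ φ) ⬝ᵥ (H *ᵥ (B *ᵥ φ)) - ((H.minEnergyOn K : ℝ) : ℂ) * (star (B *ᵥ φ) ⬝ᵥ (B *ᵥ φ)) := by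
    rw [← mulVec_mulVec, sub_mulVec, ← mulVec_mulVec, ← mulVec_mulVec, hφ, mulVec_smul, dotProduct_mulVec,
      ← star_mulVec, dotProduct_sub, dotProduct_smul, smul_eq_mul]
  have hreal : ∀ w : ι → ℂ, (star w ⬝ᵥ (H *ᵥ w)).im = 0 := by
    intro w
    have h : star (star w ⬝ᵥ (H *ᵥ w)) = star w ⬝ᵥ (H *ᵥ w) := by
      conv_lhs => rw [star_dotProduct, star_star, star_mulVec, ← dotProduct_mulVec, hH.eq]
    have := congrArg Complex.im h
    rw [Complex.star_def, Complex.conj_im] at this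
    linarith
  have hb : (0 : ℂ) ≤ star (B *ᵥ φ) ⬝ᵥ (B *ᵥ φ) := dotProduct_star_self_nonneg _
  obtain ⟨-, hbim⟩ := Complex.nonneg_iff.1 hb
  have hE := minEnergyOn_mul_le_re_rayleigh_of_mem hH K (hBK φ hφK)
  rw [hexp, Complex.nonneg_iff]
  refine ⟨?_, ?_⟩
  · rw [Complex.sub_re, Complex.re_ofReal_mul]
    linarith
  · rw [Complex.sub_im, Complex.im_ofReal_mul, hreal, ← hbim, mul_zero, sub_zero]

end FiniteVolume

/-! ### Embedded gauge-invariant observables preserve the sectors of the torus -/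

section Torus

variable {d : ℕ} (L : ℕ) [NeZero L]

/-- The orbitals of an embedded region lie over its image sites. [folklore] -/
theorem orbs_map_toTorusEmb_subset {Λ : Finset (Site d)} (h : Set.InjOn (Torus.proj (d := d) L) ↑Λ) :
    orbs ((Finset.univ : Finset (PolySite Λ)).map (PolySite.toTorusEmb L h)) ⊆
      orbs (Λ.image fun x => FermionTorus.ofTorusSite (Torus.proj L x)) := by
  intro i hi
  rw [mem_orbs] at hi ⊢
  obtain ⟨p, -, hp⟩ := Finset.mem_map.1 hi
  exact Finset.mem_image.2 ⟨ofLex p.1, PolySite.ofLex_mem p, by rw [← hp, PolySite.toTorusEmb_apply]⟩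

/-- **Sums of site-local even terms over the torus commute with embedded observables that commute
with the corresponding local sum.** If `g a ∈ 𝔄⁺({a})` for every torus site `a`, `Γ` maps the local
terms `gloc` to `g` on the image, and `A` commutes with `Σ_p gloc p`, then `Γ A` commutes with
`Σ_a g a` (the image part is `Γ(Σ gloc)`, the rest is even and far from the image).
[cite: BratteliRobinsonII1997, §5.2.2] -/
theorem commute_fermionEmbed_toTorusEmb_sum {Λ : Finset (Site d)} (h : Set.InjOn (Torus.proj (d := d) L) ↑Λ)
    (A : FermionOp Λ) (g : FermionTorus d L → Matrix (Finset (Orb (FermionTorus d L))) (Finset (Orb (FermionTorus d L))) ℂ)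
    (gloc : PolySite Λ → FermionOp Λ) (hg : ∀ a, g a ∈ carEvenSubalgebra (orbs {a}))
    (hgg : ∀ p : PolySite Λ, fermionEmbed (PolySite.toTorusEmb L h) (gloc p) = g (PolySite.toTorusEmb L h p))
    (hA : Commute A (∑ p, gloc p)) :
    Commute (fermionEmbed (PolySite.toTorusEmb L h) A) (∑ a, g a) := by
  have hι : Set.InjOn (fun x : Site d => FermionTorus.ofTorusSite (Torus.proj L x)) ↑Λ := injOn_ofTorusSite_proj L h
  -- the image part is `Γ(Σ gloc)`
  have himage : ∑ a ∈ Λ.image (fun x => FermionTorus.ofTorusSite (Torus.proj L x)), g a =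
      fermionEmbed (PolySite.toTorusEmb L h) (∑ p, gloc p) := by
    let e : PolySite Λ ≃ {x // x ∈ Λ} :=
      ⟨fun a => ⟨ofLex a.1, PolySite.ofLex_mem a⟩, fun x => PolySite.pt x.1 x.2, fun a => PolySite.pt_ofLex a,
        fun x => Subtype.ext rfl⟩
    rw [Finset.sum_image hι, fermionEmbed_sum, ← Finset.sum_attach Λ, ← Finset.univ_eq_attach]
    refine (Fintype.sum_equiv e _ _ fun a => ?_).symm
    rw [hgg, show PolySite.toTorusEmb L h a = FermionTorus.ofTorusSite (Torus.proj L (e a).1) from rfl]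
  -- the rest is even and far from the image
  have hfar : ∑ a ∈ (Λ.image (fun x => FermionTorus.ofTorusSite (Torus.proj L x)))ᶜ, g a ∈
      carEvenSubalgebra (orbs (Λ.image fun x => FermionTorus.ofTorusSite (Torus.proj L x)))ᶜ := by
    refine sum_mem fun a ha => carEvenSubalgebra_mono (fun i hi => ?_) (hg a)
    rw [mem_orbs, Finset.mem_singleton] at hi
    rw [Finset.mem_compl, mem_orbs, hi]
    exact Finset.mem_compl.1 ha
  rw [← Finset.sum_add_sum_compl (Λ.image fun x => FermionTorus.ofTorusSite (Torus.proj L x)), himage]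
  refine Commute.add_right ?_ ?_
  · rw [Commute, SemiconjBy, ← fermionEmbed_mul, hA.eq, fermionEmbed_mul]
  · exact (commute_of_mem_carEvenSubalgebra hfar (fermionEmbed_mem_carSubalgebra _ A)
      (disjoint_compl_left_iff.2 (orbs_map_toTorusEmb_subset L h))).symm

/-- **An embedded number-conserving observable conserves the particle number of the torus.**
[cite: LiebPRL1989, eqs. (1)–(2)] -/
theorem commute_fermionEmbed_toTorusEmb_totalNumber {Λ : Finset (Site d)} (h : Set.InjOn (Torus.proj (d := d) L) ↑Λ)
    {A : FermionOp Λ} (hA : Commute A totalNumber) :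
    Commute (fermionEmbed (PolySite.toTorusEmb L h) A)
      (totalNumber : Matrix (Finset (Orb (FermionTorus d L))) (Finset (Orb (FermionTorus d L))) ℂ) :=
  commute_fermionEmbed_toTorusEmb_sum L h A (fun a => ∑ σ : Fin 2, numberOp a σ) (fun p => ∑ σ : Fin 2, numberOp p σ)
    (fun a => sum_mem fun σ _ => numberOp_mem_carEvenSubalgebra (orb_mem_orbs.2 (Finset.mem_singleton_self a)))
    (fun p => by rw [fermionEmbed_sum, Finset.sum_congr rfl fun σ _ => fermionEmbed_numberOp _ p σ]) hA

/-- **An embedded `S^z`-conserving observable conserves the `S^z` of the torus.**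
[cite: LiebPRL1989, eqs. (1)–(2)] -/
theorem commute_fermionEmbed_toTorusEmb_spinZ {Λ : Finset (Site d)} (h : Set.InjOn (Torus.proj (d := d) L) ↑Λ)
    {A : FermionOp Λ} (hA : Commute A HubbardWave0.spinZ) :
    Commute (fermionEmbed (PolySite.toTorusEmb L h) A)
      (HubbardWave0.spinZ : Matrix (Finset (Orb (FermionTorus d L))) (Finset (Orb (FermionTorus d L))) ℂ) := by
  -- `A` commutes with `2 S^z_Λ = Σ_p (n_{p↑} - n_{p↓})`
  have hA' : Commute A (∑ p : PolySite Λ, (numberOp p 0 - numberOp p 1)) := by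
    have h2 : (2 : ℂ) • (HubbardWave0.spinZ : FermionOp Λ) = ∑ p : PolySite Λ, (numberOp p 0 - numberOp p 1) := by
      rw [HubbardWave0.spinZ, smul_smul, mul_one_div_cancel (two_ne_zero' ℂ), one_smul]
    rw [← h2, Commute, SemiconjBy, Matrix.mul_smul, Matrix.smul_mul, hA.eq]
  have hS := commute_fermionEmbed_toTorusEmb_sum L h A (fun a => numberOp a 0 - numberOp a 1)
    (fun p => numberOp p 0 - numberOp p 1)
    (fun a => by
      -- `sub_mem` would need the (expensive) `SubringClass` instance at this type; go through `+` and `•`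
      rw [show numberOp a 0 - numberOp a 1 = numberOp a 0 + (-1 : ℂ) • numberOp a 1 by
        rw [neg_one_smul, sub_eq_add_neg]]
      exact add_mem (numberOp_mem_carEvenSubalgebra (orb_mem_orbs.2 (Finset.mem_singleton_self a)))
        (SMulMemClass.smul_mem _ (numberOp_mem_carEvenSubalgebra (orb_mem_orbs.2 (Finset.mem_singleton_self a)))))
    (fun p => by rw [fermionEmbed_sub, fermionEmbed_numberOp, fermionEmbed_numberOp]) hA'
  rw [HubbardWave0.spinZ, Commute, SemiconjBy, Matrix.mul_smul, Matrix.smul_mul, hS.eq]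

/-! ### The ground-state inequality on the torus, and in the limit -/

variable (t U : ℝ)

/-- **Finite volume, one ground state.** For a ground state `φ` of `hubbardTorus d L t U` in a joint
sector `(N, S^z = M)`, a region `Λ` with `x ↦ x mod L` injective on `thicken (thicken Λ 1) 1`, and a
local observable `A ∈ 𝔄_Λ` conserving the local `N` and `S^z`:
`⟨φ, Γ(Ã⋆ [H_{thicken Λ 1}, Ã]) φ⟩ ≥ 0`, `Ã = A` embedded in `𝔄_{thicken Λ 1}` and `Γ` the pull-back
into the torus (`= ⟨B φ, (H_L - E₀) B φ⟩`, `B = Γ Ã`, by `hubbardTorus_commutator_fermionEmbed` and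
sector invariance of `B`). [cite: BratteliRobinsonII1997, Prop. 5.3.19] -/
theorem expect_fermionEmbed_localStability_nonneg {Λ : Finset (Site d)}
    (hInj : Set.InjOn (Torus.proj (d := d) L) ↑(thicken (thicken Λ 1) 1)) {N : ℕ} {M : ℝ}
    {φ : Fock (Orb (FermionTorus d L))} (hφ : IsGroundStateInSector (hubbardTorus d L t U) N M φ)
    {A : FermionOp Λ} (hAN : Commute A totalNumber) (hAS : Commute A HubbardWave0.spinZ) :
    0 ≤ expect (fermionEmbed (PolySite.toTorusEmb L (hInj.mono (by exact_mod_cast subset_thicken (thicken Λ 1) 1)))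
        ((fermionEmbed (PolySite.incl (subset_thicken Λ 1)) A)ᴴ *
          ((hubbardFermionInteraction d t U).localHamiltonian (thicken Λ 1) *
              fermionEmbed (PolySite.incl (subset_thicken Λ 1)) A -
            fermionEmbed (PolySite.incl (subset_thicken Λ 1)) A *
              (hubbardFermionInteraction d t U).localHamiltonian (thicken Λ 1)))) φ := by
  have hclosed : ∀ x ∈ Λ, ∀ i : Fin d, x + unitVec i ∈ thicken Λ 1 ∧ x - unitVec i ∈ thicken Λ 1 :=
    fun x hx i => ⟨add_unitVec_mem_thicken_one hx i, sub_unitVec_mem_thicken_one hx i⟩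
  have hΛ : Set.InjOn (Torus.proj (d := d) L) ↑Λ :=
    hInj.mono (by exact_mod_cast (subset_thicken Λ 1).trans (subset_thicken (thicken Λ 1) 1))
  rw [expect, fermionEmbed_mul, fermionEmbed_conjTranspose,
    ← hubbardTorus_commutator_fermionEmbed L t U (subset_thicken Λ 1) hclosed hInj A]
  -- the embedded observable, as an embedding of `Λ` itself
  have hB : fermionEmbed (PolySite.toTorusEmb L (hInj.mono (by exact_mod_cast subset_thicken (thicken Λ 1) 1)))
      (fermionEmbed (PolySite.incl (subset_thicken Λ 1)) A) = fermionEmbed (PolySite.toTorusEmb L hΛ) A := by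
    rw [fermionEmbed_fermionEmbed]
    exact congrFun (congrArg DFunLike.coe (fermionEmbed_congr fun p => rfl)) A
  rw [hB]
  have hH : (hubbardTorus d L t U).IsHermitian := hubbardTorus_isHermitian (hamiltonian_isHermitian_and_commute_holds _) t U
  exact star_dotProduct_conjTranspose_mul_commutator_mulVec_nonneg hH (szSector N M)
    (fun v hv => mulVec_mem_szSector_of_commute (commute_fermionEmbed_toTorusEmb_totalNumber L hΛ hAN)
      (commute_fermionEmbed_toTorusEmb_spinZ L hΛ hAS) hv) hφ.1 hφ.2.2

/-- **Finite volume, translation average.** The translation-averaged torus expectation of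
`Ã⋆ [H_{thicken Λ 1}, Ã]` in a sector ground state is `≥ 0` (every translate of a ground state is a
ground state of the translation-invariant `hubbardTorus`). [cite: BratteliRobinsonII1997, Prop. 5.3.19] -/
theorem torusAvgExpectAt_localStability_nonneg {Λ : Finset (Site d)}
    (hInj : Set.InjOn (Torus.proj (d := d) L) ↑(thicken (thicken Λ 1) 1)) {N : ℕ} {M : ℝ}
    {ψ : Fock (Orb (FermionTorus d L))} (hψ : IsGroundStateInSector (hubbardTorus d L t U) N M ψ)
    {A : FermionOp Λ} (hAN : Commute A totalNumber) (hAS : Commute A HubbardWave0.spinZ) :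
    0 ≤ torusAvgExpectAt L (thicken Λ 1)
        ((fermionEmbed (PolySite.incl (subset_thicken Λ 1)) A)ᴴ *
          ((hubbardFermionInteraction d t U).localHamiltonian (thicken Λ 1) *
              fermionEmbed (PolySite.incl (subset_thicken Λ 1)) A -
            fermionEmbed (PolySite.incl (subset_thicken Λ 1)) A *
              (hubbardFermionInteraction d t U).localHamiltonian (thicken Λ 1))) ψ := by
  have h₁ : Set.InjOn (Torus.proj (d := d) L) ↑(thicken Λ 1) :=
    hInj.mono (by exact_mod_cast subset_thicken (thicken Λ 1) 1)
  rw [torusAvgExpectAt_of_injOn L h₁]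
  have hsum : (0 : ℂ) ≤ ∑ v : TorusSite d L, expect (fermionEmbed (PolySite.toTorusEmb L h₁)
      ((fermionEmbed (PolySite.incl (subset_thicken Λ 1)) A)ᴴ *
        ((hubbardFermionInteraction d t U).localHamiltonian (thicken Λ 1) *
            fermionEmbed (PolySite.incl (subset_thicken Λ 1)) A -
          fermionEmbed (PolySite.incl (subset_thicken Λ 1)) A *
            (hubbardFermionInteraction d t U).localHamiltonian (thicken Λ 1))))
      ((fockTranslate v).val *ᵥ ψ) :=
    Finset.sum_nonneg fun v _ => expect_fermionEmbed_localStability_nonneg L t U hInj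
      (hψ.fockTranslate_mulVec v (relabel_translate_hubbardTorus v t U)) hAN hAS
  obtain ⟨hre, him⟩ := Complex.nonneg_iff.1 hsum
  rw [show ((Fintype.card (TorusSite d L) : ℂ))⁻¹ = (((Fintype.card (TorusSite d L) : ℝ)⁻¹ : ℝ) : ℂ) by
    push_cast; rfl, Complex.nonneg_iff, Complex.re_ofReal_mul, Complex.im_ofReal_mul, ← him, mul_zero]
  exact ⟨mul_nonneg (inv_nonneg.2 (Nat.cast_nonneg _)) hre, rfl⟩

/-- **Local stability of torus-limit states (gauge-invariant perturbations).** Let `ω` be a torus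
limit of the translation averages of sector ground states `ψ_{Ls j}` of `hubbardTorus d (Ls j) t U`
(sectors `(N_j, S^z = M_j)`), `Ls → ∞`. Then for every region `Λ` and every local observable
`A ∈ 𝔄_Λ` conserving the local particle number and `S^z`,
`ω(Ã⋆ [H_{thicken Λ 1}, Ã]) ≥ 0` (`Ã = A` embedded in `𝔄_{thicken Λ 1}`): the state cannot lower its
energy by any local, gauge- and spin-rotation(z)-invariant perturbation — the local ground-state
condition of Bratteli–Robinson II Def. 5.3.18 for these `A`. (Canonical limits need not satisfy it
for number-changing `A`.) Bratteli–Robinson II Prop. 5.3.25; Araki–Moriya (2003) §7.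
[cite: BratteliRobinsonII1997, Prop. 5.3.25] -/
theorem InfVolFermionState.IsTorusLimitOf.localStability {ω : InfVolFermionState d}
    {ψ : ∀ L, Fock (Orb (FermionTorus d L))} {Ls : ℕ → ℕ} (h : ω.IsTorusLimitOf ψ Ls)
    (hLs : Tendsto Ls atTop atTop) {N : ℕ → ℕ} {M : ℕ → ℝ}
    (hgs : ∀ j, IsGroundStateInSector (hubbardTorus d (Ls j) t U) (N j) (M j) (ψ (Ls j)))
    {Λ : Finset (Site d)} {A : FermionOp Λ} (hAN : Commute A totalNumber) (hAS : Commute A HubbardWave0.spinZ) :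
    0 ≤ ω.expect (thicken Λ 1)
        ((fermionEmbed (PolySite.incl (subset_thicken Λ 1)) A)ᴴ *
          ((hubbardFermionInteraction d t U).localHamiltonian (thicken Λ 1) *
              fermionEmbed (PolySite.incl (subset_thicken Λ 1)) A -
            fermionEmbed (PolySite.incl (subset_thicken Λ 1)) A *
              (hubbardFermionInteraction d t U).localHamiltonian (thicken Λ 1))) := by
  refine ge_of_tendsto (h (thicken Λ 1) _) ?_
  filter_upwards [eventually_injOn_proj_of_tendsto (thicken (thicken Λ 1) 1) hLs, hLs.eventually_ge_atTop 1]
    with j hInj hj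
  haveI : NeZero (Ls j) := ⟨by omega⟩
  rw [torusAvgExpect_eq]
  exact torusAvgExpectAt_localStability_nonneg (Ls j) t U hInj (hgs j) hAN hAS

/-- **The same in Bratteli–Robinson form**: `-i ω(Ã⋆ δ(A)) ≥ 0` with the derivation
`δ = (hubbardFermionInteraction d t U).derivation 1` (`δ(A) = i[H_{thicken Λ 1}, Ã]`), for every
local `A` conserving the local `N` and `S^z` — i.e. the defining inequality of
`InfVolFermionState.IsGroundState` restricted to the gauge-invariant observables.
[cite: BratteliRobinsonII1997, Def. 5.3.18 and Prop. 5.3.25] -/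
theorem InfVolFermionState.IsTorusLimitOf.neg_I_mul_expect_derivation_nonneg {ω : InfVolFermionState d}
    {ψ : ∀ L, Fock (Orb (FermionTorus d L))} {Ls : ℕ → ℕ} (h : ω.IsTorusLimitOf ψ Ls)
    (hLs : Tendsto Ls atTop atTop) {N : ℕ → ℕ} {M : ℕ → ℝ}
    (hgs : ∀ j, IsGroundStateInSector (hubbardTorus d (Ls j) t U) (N j) (M j) (ψ (Ls j)))
    {Λ : Finset (Site d)} {A : FermionOp Λ} (hAN : Commute A totalNumber) (hAS : Commute A HubbardWave0.spinZ) :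
    0 ≤ -Complex.I * ω.expect (thicken Λ 1)
        ((fermionEmbed (PolySite.incl (subset_thicken Λ 1)) A)ᴴ * (hubbardFermionInteraction d t U).derivation 1 Λ A) := by
  rw [FermionInteraction.derivation, Matrix.mul_smul, map_smul, smul_eq_mul, ← mul_assoc,
    show -Complex.I * Complex.I = 1 by rw [neg_mul, Complex.I_mul_I, neg_neg], one_mul]
  exact h.localStability t U hLs hgs hAN hAS

end Torus

end Literature.MathematicalPhysics.QuantumLattice

end
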